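import Summits.QuantumFields.YangMills.Theses.LangevinControlUV
import Summits.QuantumFields.YangMills.Theorems.LatticeGapInUVUnits.Negative.WeakCouplingConcentration
import Summits.QuantumFields.YangMills.Theorems.LatticeGapInUVUnits.Negative.UniformConstantFalse
import Literature.MathematicalPhysics.QuantumFieldTheory.LatticeGaugeProofs
import Literature.MathematicalPhysics.QuantumLattice.WilsonFermionBlockAveraging

/-!
# Line `femto-sigma-algebra-split` — skeleton for crux `LatticeGapInUVUnits` (stmt-QuantumFields-9366)

Crux = rank-5 item of route `LangevinControlUV` (rev 7), the IMPORTED infrared leg in the units of the UV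
engine: `Summit.QuantumFields.YangMills.Theses.LangevinControlUV.LatticeGapInUVUnits` — for every compact
simple `G`, faithful unitary `r` and every unit map `a` carrying the femto two-point package
(`Package r a`, §0), all pairs of gauge-invariant local lattice observables cluster exponentially at rate
`c₁ · a(β)` per lattice step, uniformly in the volume `(2S+1)⁴`, `S ≥ S₁(β)`, `n ≤ S` (`Concl r a`).

Idea card `Cruxes/LatticeGapInUVUnits/Ideas/femto-sigma-algebra-split.md` (ideator 3), sharpened by the
r1 triage panel (TRIAGE-r1-1/2/3: pass ×3; merge-noted with `dyadic-ladder-rate-transport` as "one IR residue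
in three clothings"):

* the lever: the law of TOTAL COVARIANCE over the femto block-average σ-algebra `𝓕 = σ(blockField)` of
  Wilson's measure — `Cov(A, τ_n B) = Cov(E[A|𝓕], E[τ_nB|𝓕]) + E[Cov(A, τ_nB | 𝓕)]`, EXACT, no cross terms —
  splits the crux into an ultraviolet term (conditional covariances given the block field decay at the block
  scale `ℓ_f`, even for the massless Gaussian part: Bałaban / Gawędzki–Kupiainen constrained propagators)
  and an infrared term that, after localising the conditional expectations (quasi-locality, the card's P1),
  is the clustering of LOCAL BOUNDED FUNCTIONALS OF THE BLOCK FIELD under `μ_β` — i.e. of the block-field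
  law on a FIXED finite-dimensional coarse field space, where `β → ∞` enters only through the block side
  `b(β) = ⌈ℓ_f / a(β)⌉` (the card's K1: "pay for dimensional transmutation once");
* the σ-algebra is PINNED, not existential (an `∃ 𝓕` would be a costume: `𝓕 = ⊤` puts the whole crux in the
  IR term, `𝓕 = ⊥` in the UV term): `blockField r b` = the covariant LINEAR block average, in the
  representation `r`, of the `b⁴` taxi-dressed straight transporters of length `b` of each block
  (Bałaban, CMP 98 (1985) §1; CMP 119 (1988) (0.1); the tree's `transport` / `lineHolonomy`) — the
  Gawędzki–Kupiainen / Bałaban averaging `Q` (captures the block zero modes, Poincaré on zero-average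
  fluctuations ⇒ unit mass at the block scale), NOT decimation (tree `GaugeCovariantBlockMap.central` /
  `axialBlockHolonomy`: conditioning on a line skeleton gives decay only at lattice scale `≍ b^{3/2}`, the
  UV stub would be false) — triage r1-3 "needs D1 before K2 is typable" is thereby met without waiting;
* the card's `Transfer C⁺ := K2 ∧ K1 ∧ P1` is the stub set: `FluctuationCovarianceDecay` (K2),
  `CondExpLocality` (P1), `BlockLawClustering` (K1 in the triage's sharpened form: clustering of local
  bounded block functionals with sup-norm constants `K M₁ M₂ e^{m₁R}`, uniformly in `β ≥ β₂` and
  `S ≥ S₁(β)` — a statement about the femto block-field laws only); the SPLIT itself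
  (`TotalCovarianceSplit`) is PROVED here (`totalCovarianceSplit`: `condExp` pull-out + tower +
  translation invariance of Wilson's measure), as is all the bookkeeping (`abs_cov_le_of_approx`,
  measurability of the block field, `𝓕_b^{x₀,R} ≤ 𝓕_b ≤ Borel`).

Four registered stubs `stub_*` — three PHYSICS stubs and the defect carrier `stub_rulerReduction` (stub 0:
the crux's known typed `∀ a` misstatement parked in ONE named place, as in the sibling lines) — two
kernel-checked sorry-free compositions `physicsStubsImplyRepaired : FluctuationCovarianceDecay →
CondExpLocality → BlockLawClustering → CruxRepaired` (the refuter's repaired crux C′, continuous rulers) and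
`stubsImplyCrux : RulerReduction → (the three) → LatticeGapInUVUnits` (wrapped as `def`s), the skeleton
`LatticeGapInUVUnits_of : LatticeGapInUVUnits` (crux BY NAME from the four stubs) and
`cruxRepaired_of_stubs : CruxRepaired` (from the three physics stubs alone). Hardest: `stub_blockLawClustering`
(the residual crux: the mass gap of ONE family of unit-lattice effective theories at the femto scale,
`ξ_coarse = O(1/(Λℓ_f))` blocks — fixed-coupling, no moving unit; intended route RTConvergence +
FixedActionGap + DS-openness, see the line card).
Composition: K2 and P1 give femto thresholds `ℓ*`, K1 picks `ℓ_f ≤ min ℓ*`; per pair `(A, B)` the IR term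
is within `2‖B‖∞‖E[A|𝓕] − F₁‖₁ + 2C_A‖E[τ_nB|𝓕] − F₂‖₁` of `Cov(F₁, F₂)` for the local approximants of P1 at
coarse radius `R = ⌊θ a(β) n⌋`, `θ = c₁ / (2 max(m₁,1))`; rate `min(c₂, c₁/2, κθ)`.

Disproof used (`Cruxes/LatticeGapInUVUnits/Disproof.lean` v5, cdisprove gen 1; verdict: NO formal kill,
MISSTATED ON PAPER — the `∀ a` admits slow step rulers for which `Package` is physically true and `Concl`
physically false; repair C′ = `Continuous a`; no `_false_without_<H>` theorem exists to honour):
§0 `crux_iff` — copied verbatim (§0 below; crux workfiles are not importable); §1 `conclRate_zero` /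
`concl_of_eventually_le` — every stub concludes a rate `c · a(β) · n` with `c > 0` existential and only SLOW
rulers threaten them (copied as `concl_of_eventually_le`, used by `stubsImplyCrux`); §2 scale covariance
`a ↦ t a` — absorbed by `ℓ_f ↦ t ℓ_f` (`blockSize` depends on `ℓ_f / a` only; `concl_smul_iff` copied, used by
`stubsImplyCrux`); §9 `CruxRepaired` — copied verbatim, it is the conclusion of `physicsStubsImplyRepaired`; §4 `Tendsto a → 0` load-bearing — used essentially: `b(β) → ∞` is what makes K1 a
statement about an RG limit (at constant `a` K1 would be a fixed-`k` effective theory with no convergence);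
§6 tightness `Γ(a β) → 0` — no stub assumes `inf Γ > 0` (checked below against the LANDED lemma
`Negative.shape_tendsto_zero_of_femto_lower_bound`: `packageWith_shape_tendsto_zero`); §7 / landed
`Negative.not_uniform_constant_clustering_of_simple` — all constants are per pair (`∀ A B, ∃ C`) and K1
scales with the sup norms `M₁ M₂` (example below); §3 / landed `Negative.not_femto_lower_bound_of_subsingleton`
— the package is unsatisfiable for a trivial group, so the four stubs (all take `Package r a`) are vacuous
there, no junk instance (`not_package_of_subsingleton` below). THE TYPED DEFECT IS ISOLATED, NOT PAPERED
OVER: `BlockLawClustering` carries `Continuous a` (without it, it would be physically false exactly on the slow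
junk rulers where the crux is: their "femto" blocks are deep-UV and the block law approaches no renormalised
trajectory), and the passage from continuous to arbitrary rulers is the defect carrier `stub_rulerReduction`
(do not staff; moot under C′ — PROVER NOTE of the Disproof: restricting 9363/9366 to continuous unit maps costs
the route's `closes` nothing).
-/

open MeasureTheory Filter Topology
open Literature.MathematicalPhysics.QuantumFieldTheory Literature.MathematicalPhysics.QuantumLattice
open Summit.QuantumFields.YangMills.Theses.LangevinControlUV

noncomputable section

namespace Summit.QuantumFields.YangMills.Cruxes.LatticeGapInUVUnits.FemtoSigmaAlgebraSplit

/-! ## §0 Anatomy of the crux (verbatim the standing disprover's `Disproof.lean` §0, copied because crux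
workfiles are not importable): `LatticeGapInUVUnits ↔ ∀ G r a, Package r a → Concl r a`. -/

section Anatomy

variable {G : Type} [Group G] [TopologicalSpace G] [IsTopologicalGroup G] [CompactSpace G]
  [MeasurableSpace G] [BorelSpace G]

/-- The femto two-point bounds in ONE periodic box `(ℤ/L)⁴` at coupling `β` (the `let`-body of the crux's
hypothesis). -/
def BoxBounds (r : LatticeRep G) (a Γ : ℝ → ℝ) (c C : ℝ) (L : ℕ) [NeZero L] (β : ℝ) : Prop :=
  let P : (Fin 4 → ZMod L) → Fin 4 → Fin 4 → GaugeConfig 4 L G → ℝ :=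
    fun x i j U => (r.N : ℝ) - (r.ρ (plaquetteHolonomy U x i j)).trace.re
  let E : (GaugeConfig 4 L G → ℝ) → ℝ := fun F => wilsonExpectation (d := 4) (L := L) r.ρ β F
  let cov : (GaugeConfig 4 L G → ℝ) → (GaugeConfig 4 L G → ℝ) → ℝ :=
    fun F F' => E (fun U => F U * F' U) - E F * E F'
  let dist : (Fin 4 → ZMod L) → (Fin 4 → ZMod L) → ℝ :=
    fun x y => Real.sqrt (∑ k : Fin 4, (((x k - y k).valMinAbs : ℤ) : ℝ) ^ 2)
  (∀ n : ℕ, 1 ≤ n → 8 * n ≤ L →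
      c * Γ ((n : ℝ) * a β) ≤ (n : ℝ) ^ 8 * cov (P 0 0 1) (P (Pi.single (2 : Fin 4) ((n : ℕ) : ZMod L)) 0 1) ∧
        (n : ℝ) ^ 8 * cov (P 0 0 1) (P (Pi.single (2 : Fin 4) ((n : ℕ) : ZMod L)) 0 1) ≤ C * Γ ((n : ℝ) * a β)) ∧
    (∀ (x y : Fin 4 → ZMod L) (i j i' j' : Fin 4), x ≠ y → i ≠ j → i' ≠ j' →
      |cov (P x i j) (P y i' j')| * dist x y ^ 8 ≤ C * Γ (dist x y * a β))

/-- The femto two-point PACKAGE of the unit map `a` with explicit witnesses. -/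
def PackageWith (r : LatticeRep G) (a Γ : ℝ → ℝ) (β₀ ℓ₀ c C : ℝ) : Prop :=
  0 < ℓ₀ ∧ 0 < c ∧ (∀ β, 0 < a β) ∧ Tendsto a atTop (𝓝 0) ∧
    (∀ s : ℝ, 0 < s → s ≤ ℓ₀ → 0 < Γ s ∧ Γ s ≤ 1) ∧
      ∀ (L : ℕ) [NeZero L] (β : ℝ), β₀ ≤ β → (L : ℝ) * a β ≤ ℓ₀ → BoxBounds r a Γ c C L β

/-- The hypothesis of the crux on the unit map `a`: the femto two-point package. -/
def Package (r : LatticeRep G) (a : ℝ → ℝ) : Prop :=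
  ∃ (Γ : ℝ → ℝ) (β₀ ℓ₀ c C : ℝ), PackageWith r a Γ β₀ ℓ₀ c C

/-- The conclusion of the crux: volume-uniform exponential clustering of all pairs of gauge-invariant local
observables at SOME rate `c₁ a(β)` per lattice step, per-pair constants. -/
def Concl (r : LatticeRep G) (a : ℝ → ℝ) : Prop :=
  ∃ (c₁ β₂ : ℝ) (S₁ : ℝ → ℕ), 0 < c₁ ∧ ∀ A B : YMSpecies G, ∃ C : ℝ, ∀ β : ℝ, β₂ ≤ β → ∀ S n : ℕ,
    S₁ β ≤ S → n ≤ S → |latticeConnectedCorr r.ρ β (2 * S + 1) A.F B.F n| ≤ C * Real.exp (-(c₁ * a β * n))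

/-- The conclusion at a prescribed rate constant `c₁` (Disproof §0). -/
def ConclRate (r : LatticeRep G) (a : ℝ → ℝ) (c₁ : ℝ) : Prop :=
  ∃ (β₂ : ℝ) (S₁ : ℝ → ℕ), ∀ A B : YMSpecies G, ∃ C : ℝ, ∀ β : ℝ, β₂ ≤ β → ∀ S n : ℕ, S₁ β ≤ S → n ≤ S →
    |latticeConnectedCorr r.ρ β (2 * S + 1) A.F B.F n| ≤ C * Real.exp (-(c₁ * a β * n))

/-- `Concl` is `∃ c₁ > 0, ConclRate c₁` (Disproof §0). -/
theorem concl_iff_exists_rate (r : LatticeRep G) (a : ℝ → ℝ) :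
    Concl r a ↔ ∃ c₁ : ℝ, 0 < c₁ ∧ ConclRate r a c₁ := by
  constructor
  · rintro ⟨c₁, β₂, S₁, hc, h⟩
    exact ⟨c₁, hc, β₂, S₁, h⟩
  · rintro ⟨c₁, hc, β₂, S₁, h⟩
    exact ⟨c₁, β₂, S₁, hc, h⟩

/-- Rescaling the unit map rescales the rate constant (Disproof §2). -/
theorem conclRate_smul_iff (r : LatticeRep G) (a : ℝ → ℝ) (c₁ t : ℝ) :
    ConclRate r (fun β => t * a β) c₁ ↔ ConclRate r a (c₁ * t) := by
  simp only [ConclRate, mul_assoc]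

/-- **Scale covariance of the conclusion** (Disproof §2 `concl_smul_iff`, copied): `Concl (t a) ↔ Concl a` for
`t > 0` — the rate constant is not intrinsic. -/
theorem concl_smul_iff (r : LatticeRep G) (a : ℝ → ℝ) {t : ℝ} (ht : 0 < t) :
    Concl r (fun β => t * a β) ↔ Concl r a := by
  rw [concl_iff_exists_rate, concl_iff_exists_rate]
  constructor
  · rintro ⟨c₁, hc, h⟩
    exact ⟨c₁ * t, mul_pos hc ht, (conclRate_smul_iff r a c₁ t).1 h⟩
  · rintro ⟨c₁, hc, h⟩
    refine ⟨c₁ / t, div_pos hc ht, (conclRate_smul_iff r a (c₁ / t) t).2 ?_⟩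
    rwa [div_mul_cancel₀ c₁ ht.ne']

/-- **The conclusion only weakens along eventual minorants of the unit map** (Disproof §1
`concl_of_eventually_le`, copied): only SLOW rulers threaten a line. -/
theorem concl_of_eventually_le (r : LatticeRep G) {a b : ℝ → ℝ} (h : Concl r a)
    (hba : ∀ᶠ β in atTop, b β ≤ a β) : Concl r b := by
  obtain ⟨c₁, β₂, S₁, hc, h⟩ := h
  obtain ⟨βs, hβs⟩ := eventually_atTop.1 hba
  refine ⟨c₁, max β₂ βs, S₁, hc, fun A B => ?_⟩
  obtain ⟨C, hC⟩ := h A B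
  refine ⟨max C 0, fun β hβ S n hS hn => ?_⟩
  have hβ₂ : β₂ ≤ β := (le_max_left _ _).trans hβ
  have hle : b β ≤ a β := hβs β ((le_max_right _ _).trans hβ)
  refine (hC β hβ₂ S n hS hn).trans ?_
  have hn0 : (0 : ℝ) ≤ n := Nat.cast_nonneg n
  have key : c₁ * b β * n ≤ c₁ * a β * n :=
    mul_le_mul_of_nonneg_right (mul_le_mul_of_nonneg_left hle hc.le) hn0
  calc C * Real.exp (-(c₁ * a β * n)) ≤ max C 0 * Real.exp (-(c₁ * a β * n)) :=
        mul_le_mul_of_nonneg_right (le_max_left _ _) (Real.exp_pos _).le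
    _ ≤ max C 0 * Real.exp (-(c₁ * b β * n)) :=
        mul_le_mul_of_nonneg_left (Real.exp_le_exp.2 (neg_le_neg key)) (le_max_right _ _)

end Anatomy

/-- **The crux uncurried** (definitional unfolding). -/
theorem crux_iff :
    LatticeGapInUVUnits ↔
      ∀ (G : Type) [Group G] [TopologicalSpace G] [IsTopologicalGroup G] [CompactSpace G],
        IsCompactSimpleLieGroup G →
          letI : MeasurableSpace G := borel G
          haveI : BorelSpace G := ⟨rfl⟩
          ∀ (r : LatticeRep G) (a : ℝ → ℝ), Package r a → Concl r a := by
  constructor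
  · intro h G _ _ _ _ hG r a hP
    obtain ⟨Γ, β₀, ℓ₀, c, C, hℓ, hc, hpos, hlim, hΓ, hbox⟩ := hP
    exact h G hG r a ⟨Γ, β₀, ℓ₀, c, C, hℓ, hc, hpos, hlim, hΓ, fun L _ β h₁ h₂ => hbox L β h₁ h₂⟩
  · intro h G _ _ _ _ hG r a hP
    obtain ⟨Γ, β₀, ℓ₀, c, C, hℓ, hc, hpos, hlim, hΓ, hbox⟩ := hP
    exact h G hG r a ⟨Γ, β₀, ℓ₀, c, C, hℓ, hc, hpos, hlim, hΓ, fun L _ β h₁ h₂ => hbox L β h₁ h₂⟩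

/-- **The repaired crux C′** (verbatim the standing disprover's `Disproof.lean` §9 `CruxRepaired`): the same
statement restricted to CONTINUOUS unit maps — the honest "mass gap `≥ c₁` in physical units" that the slow step
rulers of the paper kill cannot touch. The three PHYSICS stubs of this line prove it (`cruxRepaired_of_stubs`). -/
def CruxRepaired : Prop :=
  ∀ (G : Type) [Group G] [TopologicalSpace G] [IsTopologicalGroup G] [CompactSpace G],
    IsCompactSimpleLieGroup G →
      letI : MeasurableSpace G := borel G
      haveI : BorelSpace G := ⟨rfl⟩
      ∀ (r : LatticeRep G) (a : ℝ → ℝ), Continuous a → Package r a → Concl r a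

/-- C′ is implied by the crux as filed (it only removes unit maps from the `∀`). -/
theorem cruxRepaired_of_crux (h : LatticeGapInUVUnits) : CruxRepaired := by
  rw [crux_iff] at h
  intro G _ _ _ _ hG r a _ hP
  exact h G hG r a hP

/-! ## §1 The femto block-average σ-algebra (a concrete, pinned choice) -/

section Blocks

variable {G : Type} [Group G] {L : ℕ} [NeZero L]

/-- Block index of a torus site along axis `i` for blocks of side `b`: `⌊xᵢ / b⌋`, the incomplete last
block being merged into its predecessor (so every block has side in `[b, 2b)` when `b ≤ L`). -/
def blockIdx (b : ℕ) (x : Fin 4 → ZMod L) (i : Fin 4) : ℕ :=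
  min ((x i).val / b) (L / b - 1)

/-- The corner (representative site) of the block of `x`. -/
def blockCorner (b : ℕ) (x : Fin 4 → ZMod L) : Fin 4 → ZMod L :=
  fun i => ((b * blockIdx b x i : ℕ) : ZMod L)

/-- The offset of `x` from the corner of its block. -/
def blockOffset (b : ℕ) (x : Fin 4 → ZMod L) (i : Fin 4) : ℕ :=
  (x i).val - b * blockIdx b x i

/-- The coordinate-ordered taxi path from the corner of the block of `x` to `x` (Bałaban's `Γ_{y,x}`). -/
def blockPath (b : ℕ) (x : Fin 4 → ZMod L) : List (Fin 4) :=
  ((List.finRange 4).map fun i => List.replicate (blockOffset b x i) i).flatten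

/-- The taxi-dressed straight transporter of `b` steps in direction `μ` from the fine site `y`:
`U(Γ_{c(y),y}) · U(y → y + b e_μ) · U(Γ_{c(y + b e_μ), y + b e_μ})⁻¹` — Bałaban's block link variable
before averaging (CMP 98 (1985) §1; CMP 119 (1988) (0.1)), built from the tree's `transport` and
`lineHolonomy`. -/
def dressedLine (b : ℕ) (U : GaugeConfig 4 L G) (y : Fin 4 → ZMod L) (μ : Fin 4) : G :=
  transport U (blockCorner b y) (blockPath b y) * lineHolonomy U μ b y *
    (transport U (blockCorner b (y + Pi.single μ ((b : ℕ) : ZMod L)))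
      (blockPath b (y + Pi.single μ ((b : ℕ) : ZMod L))))⁻¹

variable [TopologicalSpace G]

open Classical in
/-- The **covariant linear block average** of the dressed straight transporters over the block of `x`, in
the representation `r`: an `N × N` complex matrix per (block, direction), with values in the convex hull of
`r(G)` (a compact, `β`-independent coarse field space). Its σ-algebra is the femto block-average σ-algebra
of the line (the Gawędzki–Kupiainen / Bałaban linear averaging `Q`, made gauge covariant by the taxi
transporters — Bałaban CMP 98 (1985) §1 before the non-linear projection to `G`; NOT decimation). -/
def blockAvg (r : LatticeRep G) (b : ℕ) (U : GaugeConfig 4 L G) (x : Fin 4 → ZMod L) (μ : Fin 4) :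
    Matrix (Fin r.N) (Fin r.N) ℂ :=
  ((Finset.univ.filter (fun y : Fin 4 → ZMod L => blockCorner b y = blockCorner b x)).card : ℂ)⁻¹ •
    ∑ y ∈ Finset.univ.filter (fun y : Fin 4 → ZMod L => blockCorner b y = blockCorner b x),
      r.ρ (dressedLine b U y μ)

/-- The block field: all matrix entries of all block averages. -/
def blockField (r : LatticeRep G) (b : ℕ) (U : GaugeConfig 4 L G) :
    (Fin 4 → ZMod L) → Fin 4 → Fin r.N → Fin r.N → ℂ :=
  fun x μ i j => blockAvg r b U x μ i j

/-- Blocks within coarse `ℓ^∞`-distance `R` of the block of `x₀` (torus distance of the corners `≤ R b`). -/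
def IsNearBlock (b : ℕ) (x₀ : Fin 4 → ZMod L) (R : ℕ) (x : Fin 4 → ZMod L) : Prop :=
  ∀ i : Fin 4, ((blockCorner b x i - blockCorner b x₀ i).valMinAbs).natAbs ≤ R * b

open Classical in
/-- The block field restricted to the blocks near `x₀` (zero elsewhere). -/
def blockFieldNear (r : LatticeRep G) (b : ℕ) (x₀ : Fin 4 → ZMod L) (R : ℕ) (U : GaugeConfig 4 L G) :
    (Fin 4 → ZMod L) → Fin 4 → Fin r.N → Fin r.N → ℂ :=
  fun x μ i j => if IsNearBlock b x₀ R x then blockAvg r b U x μ i j else 0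

/-- **The femto block-average σ-algebra** `𝓕_b` on torus gauge fields: generated by the block field. -/
@[reducible] def blockSigma (r : LatticeRep G) (b : ℕ) : MeasurableSpace (GaugeConfig 4 L G) :=
  MeasurableSpace.comap (blockField r b) inferInstance

/-- The local block σ-algebra `𝓕_b^{x₀,R}`: generated by the block averages of the blocks within coarse
distance `R` of the block of `x₀`. -/
@[reducible] def blockSigmaNear (r : LatticeRep G) (b : ℕ) (x₀ : Fin 4 → ZMod L) (R : ℕ) :
    MeasurableSpace (GaugeConfig 4 L G) :=
  MeasurableSpace.comap (blockFieldNear r b x₀ R) inferInstance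

end Blocks

/-! ## §2 Vocabulary on the crux's tori `(ℤ/(2S+1))⁴` -/

section Vocabulary

variable {G : Type} [Group G] [TopologicalSpace G] [IsTopologicalGroup G] [CompactSpace G]
  [MeasurableSpace G] [BorelSpace G]

/-- The block side in lattice units for physical block size `ℓf` in the units `a`: `b(β) = ⌈ℓf / a(β)⌉₊`. -/
def blockSize (ℓf : ℝ) (a : ℝ → ℝ) (β : ℝ) : ℕ := ⌈ℓf / a β⌉₊

/-- Wilson's measure on the crux's torus of side `2S+1`. -/
abbrev μW (r : LatticeRep G) (β : ℝ) (S : ℕ) : Measure (GaugeConfig 4 (2 * S + 1) G) :=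
  wilsonMeasure (d := 4) (L := 2 * S + 1) r.ρ β

/-- The fine observable `A` translated by `n` lattice units in Euclidean time, on the torus of side `2S+1`
(through the periodic lift) — verbatim the integrands of `latticeConnectedCorr`. -/
def fineObs (S : ℕ) (A : YMSpecies G) (n : ℕ) : GaugeConfig 4 (2 * S + 1) G → ℝ :=
  fun U => A.F (configShift (-Pi.single 0 (n : ℤ)) (torusLift (2 * S + 1) U))

/-- The femto σ-algebra at coupling `β` for physical block size `ℓf` in the units `a`. -/
@[reducible] def femtoSigma (r : LatticeRep G) (ℓf : ℝ) (a : ℝ → ℝ) (β : ℝ) (S : ℕ) :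
    MeasurableSpace (GaugeConfig 4 (2 * S + 1) G) :=
  blockSigma r (blockSize ℓf a β)

/-- Its local version around the fine site `x₀` with coarse radius `R`. -/
@[reducible] def femtoSigmaNear (r : LatticeRep G) (ℓf : ℝ) (a : ℝ → ℝ) (β : ℝ) (S : ℕ)
    (x₀ : Fin 4 → ZMod (2 * S + 1)) (R : ℕ) : MeasurableSpace (GaugeConfig 4 (2 * S + 1) G) :=
  blockSigmaNear r (blockSize ℓf a β) x₀ R

/-- The conditional expectation `E_β[A ∘ τ_n ∘ lift | 𝓕]` of a fine observable given the femto σ-algebra. -/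
def condObs (r : LatticeRep G) (ℓf : ℝ) (a : ℝ → ℝ) (β : ℝ) (S : ℕ) (A : YMSpecies G) (n : ℕ) :
    GaugeConfig 4 (2 * S + 1) G → ℝ :=
  (μW r β S)[fineObs S A n | femtoSigma r ℓf a β S]

/-- Covariance of two real functions under a measure. -/
def cov {Ω : Type*} [MeasurableSpace Ω] (μ : Measure Ω) (f g : Ω → ℝ) : ℝ :=
  (∫ ω, f ω * g ω ∂μ) - (∫ ω, f ω ∂μ) * ∫ ω, g ω ∂μ

/-- The INFRARED term of the split: covariance of the conditional expectations. -/
def irTerm (r : LatticeRep G) (ℓf : ℝ) (a : ℝ → ℝ) (β : ℝ) (S : ℕ) (A B : YMSpecies G) (n : ℕ) : ℝ :=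
  cov (μW r β S) (condObs r ℓf a β S A 0) (condObs r ℓf a β S B n)

/-- The ULTRAVIOLET term of the split: the mean conditional covariance (fluctuation covariance). -/
def uvTerm (r : LatticeRep G) (ℓf : ℝ) (a : ℝ → ℝ) (β : ℝ) (S : ℕ) (A B : YMSpecies G) (n : ℕ) : ℝ :=
  ∫ U, (fineObs S A 0 U - condObs r ℓf a β S A 0 U) * (fineObs S B n U - condObs r ℓf a β S B n U)
    ∂(μW r β S)

end Vocabulary

/-! ## §3 The split (proved in §4) and the four stub statements -/

/-- **The exact split (PROVED below as `totalCovarianceSplit`; not a stub).** For every torus, coupling,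
block scale and pair of species, the connected torus correlator of the crux IS the infrared term plus the
ultraviolet term: `⟨A ; τ_n B⟩_{β,2S+1} = Cov(E[A|𝓕], E[τ_nB|𝓕]) + E[(A − E[A|𝓕])(τ_nB − E[τ_nB|𝓕])]`
(law of total covariance: orthogonality of conditional expectation, plus translation invariance of Wilson's
measure for the literal unshifted mean of `latticeConnectedCorr`). -/
def TotalCovarianceSplit : Prop :=
  ∀ (G : Type) [Group G] [TopologicalSpace G] [IsTopologicalGroup G] [CompactSpace G]
    [MeasurableSpace G] [BorelSpace G] (r : LatticeRep G) (ℓf : ℝ) (a : ℝ → ℝ) (β : ℝ) (S : ℕ)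
    (A B : YMSpecies G) (n : ℕ),
    latticeConnectedCorr r.ρ β (2 * S + 1) A.F B.F n = irTerm r ℓf a β S A B n + uvTerm r ℓf a β S A B n

/-- **Stub 0 statement — ruler reduction (the DEFECT CARRIER; do not staff).** Every unit map carrying the
femto package is eventually dominated, up to a constant `K₀`, by a CONTINUOUS unit map carrying the package.
This is where the crux's known typed misstatement is parked (Disproof PAPER KILL / `TypedDefect9366.md`: for the
slow step rulers of the paper kill it is physically FALSE — exactly the set on which the crux itself is; for a
continuous ruler it is the identity, `rulerReduction_of_continuous`, proved). It becomes moot the moment the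
tenure planner restates 9363/9366 for continuous unit maps (Disproof PROVER NOTE: costs `closes` nothing), and
the three physics stubs alone prove that repaired crux (`cruxRepaired_of_stubs`, checked). Unrefutable in Lean
for the same reason the crux is (a kill needs `Package` for a slow ruler = the open UV statement 9363). The
same device as the sibling lines `knabe-block-sampler` (S0) and `one-ruler` (`stub_rulerEnvelope`). -/
def RulerReduction : Prop :=
  ∀ (G : Type) [Group G] [TopologicalSpace G] [IsTopologicalGroup G] [CompactSpace G]
    [MeasurableSpace G] [BorelSpace G], IsCompactSimpleLieGroup G →
    ∀ (r : LatticeRep G) (a : ℝ → ℝ), Package r a →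
      ∃ (a' : ℝ → ℝ) (K₀ : ℝ), Continuous a' ∧ Package r a' ∧ 0 < K₀ ∧ ∀ᶠ β in atTop, a β ≤ K₀ * a' β

/-- On a continuous ruler stub 0 is the identity (`a' := a`, `K₀ := 1`). -/
theorem rulerReduction_of_continuous {G : Type} [Group G] [TopologicalSpace G] [IsTopologicalGroup G]
    [CompactSpace G] [MeasurableSpace G] [BorelSpace G] (r : LatticeRep G) {a : ℝ → ℝ} (ha : Continuous a)
    (hP : Package r a) :
    ∃ (a' : ℝ → ℝ) (K₀ : ℝ), Continuous a' ∧ Package r a' ∧ 0 < K₀ ∧ ∀ᶠ β in atTop, a β ≤ K₀ * a' β :=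
  ⟨a, 1, ha, hP, one_pos, Eventually.of_forall fun β => by rw [one_mul]⟩

/-- **Stub 1 statement — fluctuation-covariance decay (card K2, the asymptotic-freedom side).** For every
compact `G`, `r` and unit map `a` carrying the femto package there is a femto threshold `ℓ* > 0` such that for
EVERY physical block size `ℓ_f ∈ (0, ℓ*]` the ultraviolet term of the split — the `μ_β`-mean conditional
covariance of `A` and `τ_n B` given the block averages at lattice scale `b(β) = ⌈ℓ_f / a(β)⌉` — decays like
`C_{AB} e^{−c₂ a(β) n}` (i.e. at rate `≍ 1/(κℓ_f)` per physical length, `c₂ = c₂(ℓ_f)`), uniformly in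
`β ≥ β₂` and in the volume `S ≥ S₁(β)`. Mechanism: conditioned on its block averages the fluctuation field
is massive at the block scale (Poincaré for zero-average functions on a `b`-cube; Bałaban's propagators with
averaging constraints decay exponentially on the block scale uniformly in the number of steps and in small
backgrounds, CMP 95/96 (1984), CMP 99 (1985); the non-Gaussian fluctuation integral converges because the
running coupling at a femto block scale is small). `Package r a` is what keeps the block scale femto (it
excludes over-fast rulers); for the physical ruler `g(ℓ_f)` is small iff `ℓ_f` is — hence `∃ ℓ*`. Group-blind
(no simplicity hypothesis): true for `U(1)₄` as well (the massless photon sits in the IR term). XL, of a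
known kind (triage ×3). -/
def FluctuationCovarianceDecay : Prop :=
  ∀ (G : Type) [Group G] [TopologicalSpace G] [IsTopologicalGroup G] [CompactSpace G]
    [MeasurableSpace G] [BorelSpace G] (r : LatticeRep G) (a : ℝ → ℝ), Package r a →
    ∃ ℓs : ℝ, 0 < ℓs ∧ ∀ ℓf : ℝ, 0 < ℓf → ℓf ≤ ℓs →
      ∃ (c₂ β₂ : ℝ) (S₁ : ℝ → ℕ), 0 < c₂ ∧ ∀ A B : YMSpecies G, ∃ C : ℝ, ∀ β : ℝ, β₂ ≤ β →
        ∀ S n : ℕ, S₁ β ≤ S → n ≤ S →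
          |uvTerm r ℓf a β S A B n| ≤ C * Real.exp (-(c₂ * a β * n))

/-- **Stub 2 statement — quasi-locality of the conditional expectations (card P1).** Same setting and
the same `∃ ℓ*, ∀ ℓ_f ≤ ℓ*` shape: there is `κ > 0` such that for every species `A` (constant `C_A`, uniform
in `β ≥ β₂`, `S ≥ S₁(β)`, `n ≤ S` and the radius `R`) the conditional expectation `E_β[A ∘ τ_n ∘ lift | 𝓕_b]`
is within `C_A e^{−κ R}` in `L¹(μ_β)` of a function `F` of the block averages of the blocks within coarse
`ℓ^∞`-distance `R` of the block of the fine site `n e₀` (`Measurable[𝓕_b^{n e₀, R}] F`), with `|F| ≤ C_A`.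
Mechanism: the same constrained-fluctuation technology as stub 1 (exponential decay of the conditional
law's correlations away from `supp A` in block units; `C_A` absorbs `e^{κ · dist(supp A, 0)}` and `2‖A‖∞`).
`R = 0` and small `n` are consistent (`F := const`). L-sized. -/
def CondExpLocality : Prop :=
  ∀ (G : Type) [Group G] [TopologicalSpace G] [IsTopologicalGroup G] [CompactSpace G]
    [MeasurableSpace G] [BorelSpace G] (r : LatticeRep G) (a : ℝ → ℝ), Package r a →
    ∃ ℓs : ℝ, 0 < ℓs ∧ ∀ ℓf : ℝ, 0 < ℓf → ℓf ≤ ℓs →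
      ∃ (κ β₂ : ℝ) (S₁ : ℝ → ℕ), 0 < κ ∧ ∀ A : YMSpecies G, ∃ C : ℝ, ∀ β : ℝ, β₂ ≤ β →
        ∀ S n : ℕ, S₁ β ≤ S → n ≤ S → ∀ R : ℕ,
          ∃ F : GaugeConfig 4 (2 * S + 1) G → ℝ,
            Measurable[femtoSigmaNear r ℓf a β S (Pi.single 0 ((n : ℕ) : ZMod (2 * S + 1))) R] F ∧
            (∀ U, |F U| ≤ C) ∧
            ∫ U, |condObs r ℓf a β S A n U - F U| ∂(μW r β S) ≤ C * Real.exp (-(κ * R))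

/-- **Stub 3 statement — clustering of the femto block-field laws (card K1, HARDEST; the residual crux
`C⁺`).** For every compact SIMPLE `G`, `r`, CONTINUOUS unit map `a` with the femto package (the repaired
hypothesis C′ of the Disproof; the typed `∀ a` is reached through stub 0) and every threshold `ℓ* > 0` there is
a block size `ℓ_f ∈ (0, ℓ*]` and constants `c₁ > 0`, `m₁, K ≥ 0`, `β₂`, `S₁` such that for all `β ≥ β₂`, all
tori `S ≥ S₁(β)`, all `n ≤ S`, all radii `R` and all BOUNDED functionals `F₁`, `F₂` of the block averages of
the blocks within coarse distance `R` of the block of `0`, resp. of `n e₀`: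
`|Cov_{μ_β}(F₁, F₂)| ≤ K ‖F₁‖∞ ‖F₂‖∞ e^{m₁ R} e^{−c₁ a(β) n}` — exponential clustering IN TIME of local block
functionals at the physical rate `c₁ ≍ m₀/ℓ_f` (`m₀` = gap of the coarse theory per block), locality
penalty `e^{m₁R}` (so overlapping supports are consistent with the trivial bound `2‖F₁‖‖F₂‖`), constants
uniform in `β` and in the volume. Since `F₁, F₂` factor through `blockField`, this is a statement about
the LAWS of the femto block field `(blockField r b(β))_* μ_{β,2S+1}` only: probability measures on the
fixed compact coarse field space `(blocks) → (directions) → conv r(G)`, one per `(β, S)`; `β` enters only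
through `b(β) → ∞`. Intended proof route (card (3), triage r1-1/r1-3 sharpenings): RTConvergence (the laws'
effective interactions approach the renormalised trajectory at physical scale `ℓ_f` in an exponentially
weighted quasi-local norm, subsequentially, with compact closure `𝒦`) + FixedActionGap (every `S* ∈ 𝒦` has
an exponentially clustering, completely analytic Gibbs state: the MASS GAP of ONE unit-lattice action per
limit point, coarse correlation length `≍ 1/(Λ ℓ_f)` blocks) + Openness (Dobrushin–Shlosman: complete
analyticity is open in that norm — in print for finite-range interactions only). Honest status: without
`Continuous a` it would be physically FALSE on the slow junk rulers of the Disproof's paper kill (there the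
"femto" blocks are deep-UV and no RT limit is approached), which is why continuity sits in THIS stub; it fails
for `U(1)₄` (lattice Maxwell block field is massless — barrier `AbelianDeconfinementD4`, hence the simplicity
hypothesis HERE and only here); it is the Millennium content in fixed-coupling clothing. Open-problem grade. -/
def BlockLawClustering : Prop :=
  ∀ (G : Type) [Group G] [TopologicalSpace G] [IsTopologicalGroup G] [CompactSpace G]
    [MeasurableSpace G] [BorelSpace G], IsCompactSimpleLieGroup G →
    ∀ (r : LatticeRep G) (a : ℝ → ℝ), Continuous a → Package r a →
    ∀ ℓs : ℝ, 0 < ℓs → ∃ ℓf : ℝ, 0 < ℓf ∧ ℓf ≤ ℓs ∧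
      ∃ (c₁ m₁ β₂ K : ℝ) (S₁ : ℝ → ℕ), 0 < c₁ ∧ 0 ≤ m₁ ∧ 0 ≤ K ∧ ∀ β : ℝ, β₂ ≤ β →
        ∀ S n : ℕ, S₁ β ≤ S → n ≤ S → ∀ (R : ℕ) (F₁ F₂ : GaugeConfig 4 (2 * S + 1) G → ℝ) (M₁ M₂ : ℝ),
          Measurable[femtoSigmaNear r ℓf a β S 0 R] F₁ →
          Measurable[femtoSigmaNear r ℓf a β S (Pi.single 0 ((n : ℕ) : ZMod (2 * S + 1))) R] F₂ →
          (∀ U, |F₁ U| ≤ M₁) → (∀ U, |F₂ U| ≤ M₂) →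
            |cov (μW r β S) F₁ F₂| ≤ K * M₁ * M₂ * Real.exp (m₁ * R) * Real.exp (-(c₁ * a β * n))

/-! ## §4 Sorry-free infrastructure used by the composition -/

section Measurability

variable {G : Type} [Group G] [TopologicalSpace G] [IsTopologicalGroup G] {L : ℕ} [NeZero L]

omit [NeZero L] in
/-- Parallel transport along a fixed path is continuous in the gauge field. -/
theorem continuous_transport (c : Fin 4 → ZMod L) (is : List (Fin 4)) :
    Continuous fun U : GaugeConfig 4 L G => transport U c is := by
  induction is generalizing c with
  | nil => simp only [transport_nil]; exact continuous_const
  | cons i is ih => simp only [transport_cons]; exact (continuous_apply _).mul (ih _)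

omit [NeZero L] in
/-- Straight-line holonomies are continuous in the gauge field. -/
theorem continuous_lineHolonomy (k : Fin 4) (n : ℕ) (y : Fin 4 → ZMod L) :
    Continuous fun U : GaugeConfig 4 L G => lineHolonomy U k n y := by
  induction n generalizing y with
  | zero => simp only [lineHolonomy]; exact continuous_const
  | succ n ih => simp only [lineHolonomy]; exact (continuous_apply _).mul (ih _)

omit [NeZero L] in
/-- The dressed straight transporter is continuous in the gauge field. -/
theorem continuous_dressedLine (b : ℕ) (y : Fin 4 → ZMod L) (μ : Fin 4) :
    Continuous fun U : GaugeConfig 4 L G => dressedLine b U y μ :=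
  ((continuous_transport _ _).mul (continuous_lineHolonomy _ _ _)).mul (continuous_transport _ _).inv

/-- Every entry of every block average is continuous in the gauge field. -/
theorem continuous_blockAvg_apply (r : LatticeRep G) (b : ℕ) (x : Fin 4 → ZMod L) (μ : Fin 4)
    (i j : Fin r.N) : Continuous fun U : GaugeConfig 4 L G => blockAvg r b U x μ i j := by
  classical
  have hs : ∀ s : Finset (Fin 4 → ZMod L),
      Continuous fun U : GaugeConfig 4 L G => ∑ y ∈ s, r.ρ (dressedLine b U y μ) := fun s =>
    continuous_finsetSum s fun y _ => r.continuous.comp (continuous_dressedLine (L := L) b y μ)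
  have h : Continuous fun U : GaugeConfig 4 L G => blockAvg r b U x μ := by
    unfold blockAvg
    exact (hs _).const_smul (_ : ℂ)
  exact h.matrix_elem i j

variable [CompactSpace G] [MeasurableSpace G] [BorelSpace G]

omit [IsTopologicalGroup G] [MeasurableSpace G] [BorelSpace G] in
/-- A faithful matrix representation makes the compact group second countable. -/
theorem secondCountable_of_rep (r : LatticeRep G) : SecondCountableTopology G :=
  (r.continuous.isClosedEmbedding r.injective).isEmbedding.secondCountableTopology

/-- The block field is measurable (product Borel σ-algebra on torus gauge fields). -/
theorem measurable_blockField (r : LatticeRep G) (b : ℕ) : Measurable (blockField (L := L) r b) := by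
  haveI := secondCountable_of_rep r
  refine measurable_pi_lambda _ fun x => measurable_pi_lambda _ fun μ =>
    measurable_pi_lambda _ fun i => measurable_pi_lambda _ fun j => ?_
  exact (continuous_blockAvg_apply r b x μ i j).measurable

open Classical in
/-- The localised block field is measurable. -/
theorem measurable_blockFieldNear (r : LatticeRep G) (b : ℕ) (x₀ : Fin 4 → ZMod L) (R : ℕ) :
    Measurable (blockFieldNear (L := L) r b x₀ R) := by
  haveI := secondCountable_of_rep r
  refine measurable_pi_lambda _ fun x => measurable_pi_lambda _ fun μ =>
    measurable_pi_lambda _ fun i => measurable_pi_lambda _ fun j => ?_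
  by_cases h : IsNearBlock b x₀ R x
  · simp only [blockFieldNear, h, if_true]
    exact (continuous_blockAvg_apply r b x μ i j).measurable
  · simp only [blockFieldNear, h, if_false]
    exact measurable_const

/-- `𝓕_b` is a sub-σ-algebra of the Borel (product) σ-algebra of torus gauge fields. -/
theorem blockSigma_le (r : LatticeRep G) (b : ℕ) :
    blockSigma (L := L) r b ≤ (inferInstance : MeasurableSpace (GaugeConfig 4 L G)) :=
  measurable_iff_comap_le.1 (measurable_blockField r b)

/-- `𝓕_b^{x₀,R}` is a sub-σ-algebra of the Borel (product) σ-algebra of torus gauge fields. -/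
theorem blockSigmaNear_le (r : LatticeRep G) (b : ℕ) (x₀ : Fin 4 → ZMod L) (R : ℕ) :
    blockSigmaNear (L := L) r b x₀ R ≤ (inferInstance : MeasurableSpace (GaugeConfig 4 L G)) :=
  measurable_iff_comap_le.1 (measurable_blockFieldNear r b x₀ R)

omit [IsTopologicalGroup G] [CompactSpace G] [MeasurableSpace G] [BorelSpace G] in
open Classical in
/-- `𝓕_b^{x₀,R} ≤ 𝓕_b`: local block functionals are block functionals. -/
theorem blockSigmaNear_le_blockSigma (r : LatticeRep G) (b : ℕ) (x₀ : Fin 4 → ZMod L) (R : ℕ) :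
    blockSigmaNear (L := L) r b x₀ R ≤ blockSigma r b := by
  refine measurable_iff_comap_le.1 ?_
  have hφ : Measurable fun (F : (Fin 4 → ZMod L) → Fin 4 → Fin r.N → Fin r.N → ℂ) =>
      fun x μ i j => if IsNearBlock b x₀ R x then F x μ i j else 0 := by
    refine measurable_pi_lambda _ fun x => measurable_pi_lambda _ fun μ =>
      measurable_pi_lambda _ fun i => measurable_pi_lambda _ fun j => ?_
    by_cases h : IsNearBlock b x₀ R x
    · simp only [h, if_true]
      exact (measurable_pi_apply j).comp ((measurable_pi_apply i).comp
        ((measurable_pi_apply μ).comp (measurable_pi_apply x)))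
    · simp only [h, if_false]
      exact measurable_const
  have : blockFieldNear (L := L) r b x₀ R =
      (fun (F : (Fin 4 → ZMod L) → Fin 4 → Fin r.N → Fin r.N → ℂ) =>
        fun x μ i j => if IsNearBlock b x₀ R x then F x μ i j else 0) ∘ blockField r b := by
    funext U x μ i j
    simp only [blockFieldNear, blockField, Function.comp_apply]
  rw [this]
  exact hφ.comp (comap_measurable (blockField r b))

end Measurability

section Bookkeeping

variable {Ω : Type*} [MeasurableSpace Ω]

/-- Integrability of a product with an a.e.-bounded right factor. -/
theorem integrable_mul_of_bdd_right {μ : Measure Ω} {X Y : Ω → ℝ} {M : ℝ} (hX : Integrable X μ)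
    (hY : AEStronglyMeasurable Y μ) (hYb : ∀ᵐ ω ∂μ, |Y ω| ≤ M) :
    Integrable (fun ω => X ω * Y ω) μ := by
  have h := hX.bdd_mul hY (hYb.mono fun ω h => by rw [Real.norm_eq_abs]; exact h)
  simpa only [mul_comm] using h

/-- Integrability of a product with an a.e.-bounded left factor. -/
theorem integrable_mul_of_bdd_left {μ : Measure Ω} {X Y : Ω → ℝ} {M : ℝ} (hY : Integrable Y μ)
    (hX : AEStronglyMeasurable X μ) (hXb : ∀ᵐ ω ∂μ, |X ω| ≤ M) :
    Integrable (fun ω => X ω * Y ω) μ :=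
  hY.bdd_mul hX (hXb.mono fun ω h => by rw [Real.norm_eq_abs]; exact h)

/-- `|∫ u v| ≤ M ∫ |u|` when `|v| ≤ M` a.e. -/
theorem abs_integral_mul_le_right {μ : Measure Ω} {u v : Ω → ℝ} {M : ℝ} (hu : Integrable u μ)
    (hv : AEStronglyMeasurable v μ) (hvb : ∀ᵐ ω ∂μ, |v ω| ≤ M) :
    |∫ ω, u ω * v ω ∂μ| ≤ M * ∫ ω, |u ω| ∂μ := by
  have hint : Integrable (fun ω => u ω * v ω) μ := integrable_mul_of_bdd_right hu hv hvb
  calc |∫ ω, u ω * v ω ∂μ| ≤ ∫ ω, |u ω * v ω| ∂μ := abs_integral_le_integral_abs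
    _ ≤ ∫ ω, M * |u ω| ∂μ := by
        refine integral_mono_ae hint.abs (hu.abs.const_mul M) ?_
        filter_upwards [hvb] with ω hω
        rw [abs_mul, mul_comm]
        exact mul_le_mul_of_nonneg_right hω (abs_nonneg _)
    _ = M * ∫ ω, |u ω| ∂μ := integral_const_mul M _

/-- `|∫ v u| ≤ M ∫ |u|` when `|v| ≤ M` a.e. -/
theorem abs_integral_mul_le_left {μ : Measure Ω} {u v : Ω → ℝ} {M : ℝ} (hu : Integrable u μ)
    (hv : AEStronglyMeasurable v μ) (hvb : ∀ᵐ ω ∂μ, |v ω| ≤ M) :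
    |∫ ω, v ω * u ω ∂μ| ≤ M * ∫ ω, |u ω| ∂μ := by
  have := abs_integral_mul_le_right hu hv hvb
  simpa only [mul_comm] using this

/-- `|∫ v| ≤ M` when `|v| ≤ M` a.e. under a probability measure. -/
theorem abs_integral_le_of_bdd {μ : Measure Ω} [IsProbabilityMeasure μ] {v : Ω → ℝ} {M : ℝ}
    (hv : Integrable v μ) (hvb : ∀ᵐ ω ∂μ, |v ω| ≤ M) : |∫ ω, v ω ∂μ| ≤ M := by
  calc |∫ ω, v ω ∂μ| ≤ ∫ ω, |v ω| ∂μ := abs_integral_le_integral_abs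
    _ ≤ ∫ _ω, M ∂μ := integral_mono_ae hv.abs (integrable_const M) hvb
    _ = M := by simp

/-- **Covariance perturbation** (Cauchy–Schwarz-free bookkeeping of the composition): replacing `X` by an
`L¹`-close `F₁` and `Y` by an `L¹`-close `F₂` changes the covariance by at most
`2 M_Y ‖X − F₁‖₁ + 2 M₁ ‖Y − F₂‖₁`. -/
theorem abs_cov_le_of_approx (μ : Measure Ω) [IsProbabilityMeasure μ] {X Y F₁ F₂ : Ω → ℝ}
    {MY M₁ : ℝ} (hX : Integrable X μ) (hY : Integrable Y μ) (hF₁ : Integrable F₁ μ)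
    (hF₂ : Integrable F₂ μ) (hYb : ∀ᵐ ω ∂μ, |Y ω| ≤ MY) (hF₁b : ∀ᵐ ω ∂μ, |F₁ ω| ≤ M₁) :
    |cov μ X Y| ≤ |cov μ F₁ F₂| + 2 * MY * ∫ ω, |X ω - F₁ ω| ∂μ + 2 * M₁ * ∫ ω, |Y ω - F₂ ω| ∂μ := by
  -- integrable products
  have hXY : Integrable (fun ω => X ω * Y ω) μ := integrable_mul_of_bdd_right hX hY.1 hYb
  have hF₁Y : Integrable (fun ω => F₁ ω * Y ω) μ := integrable_mul_of_bdd_right hF₁ hY.1 hYb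
  have hF₁F₂ : Integrable (fun ω => F₁ ω * F₂ ω) μ := integrable_mul_of_bdd_left hF₂ hF₁.1 hF₁b
  -- the two difference covariances
  have e1 : cov μ X Y = cov μ F₁ Y + cov μ (fun ω => X ω - F₁ ω) Y := by
    unfold cov
    have h1 : (fun ω => (X ω - F₁ ω) * Y ω) = fun ω => X ω * Y ω - F₁ ω * Y ω := by
      funext ω; ring
    rw [h1, integral_sub hXY hF₁Y, integral_sub hX hF₁]
    ring
  have e2 : cov μ F₁ Y = cov μ F₁ F₂ + cov μ F₁ (fun ω => Y ω - F₂ ω) := by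
    unfold cov
    have h1 : (fun ω => F₁ ω * (Y ω - F₂ ω)) = fun ω => F₁ ω * Y ω - F₁ ω * F₂ ω := by
      funext ω; ring
    rw [h1, integral_sub hF₁Y hF₁F₂, integral_sub hY hF₂]
    ring
  -- bounds on the difference covariances
  have hI : 0 ≤ ∫ ω, |X ω - F₁ ω| ∂μ := integral_nonneg fun _ => abs_nonneg _
  have hJ : 0 ≤ ∫ ω, |Y ω - F₂ ω| ∂μ := integral_nonneg fun _ => abs_nonneg _
  have b1 : |cov μ (fun ω => X ω - F₁ ω) Y| ≤ 2 * MY * ∫ ω, |X ω - F₁ ω| ∂μ := by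
    unfold cov
    have t1 := abs_integral_mul_le_right (hX.sub hF₁) hY.1 hYb
    have t2 : |∫ ω, (X ω - F₁ ω) ∂μ| ≤ ∫ ω, |X ω - F₁ ω| ∂μ := abs_integral_le_integral_abs
    have t3 : |∫ ω, Y ω ∂μ| ≤ MY := abs_integral_le_of_bdd hY hYb
    calc |(∫ ω, (X ω - F₁ ω) * Y ω ∂μ) - (∫ ω, (X ω - F₁ ω) ∂μ) * ∫ ω, Y ω ∂μ|
        ≤ |∫ ω, (X ω - F₁ ω) * Y ω ∂μ| + |(∫ ω, (X ω - F₁ ω) ∂μ) * ∫ ω, Y ω ∂μ| := abs_sub _ _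
      _ ≤ MY * ∫ ω, |X ω - F₁ ω| ∂μ + (∫ ω, |X ω - F₁ ω| ∂μ) * MY := by
          rw [abs_mul]
          exact add_le_add t1 (mul_le_mul t2 t3 (abs_nonneg _) hI)
      _ = 2 * MY * ∫ ω, |X ω - F₁ ω| ∂μ := by ring
  have b2 : |cov μ F₁ (fun ω => Y ω - F₂ ω)| ≤ 2 * M₁ * ∫ ω, |Y ω - F₂ ω| ∂μ := by
    unfold cov
    have t1 := abs_integral_mul_le_left (hY.sub hF₂) hF₁.1 hF₁b
    have t2 : |∫ ω, (Y ω - F₂ ω) ∂μ| ≤ ∫ ω, |Y ω - F₂ ω| ∂μ := abs_integral_le_integral_abs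
    have t3 : |∫ ω, F₁ ω ∂μ| ≤ M₁ := abs_integral_le_of_bdd hF₁ hF₁b
    have hM₁ : 0 ≤ M₁ := le_trans (abs_nonneg _) t3
    calc |(∫ ω, F₁ ω * (Y ω - F₂ ω) ∂μ) - (∫ ω, F₁ ω ∂μ) * ∫ ω, (Y ω - F₂ ω) ∂μ|
        ≤ |∫ ω, F₁ ω * (Y ω - F₂ ω) ∂μ| + |(∫ ω, F₁ ω ∂μ) * ∫ ω, (Y ω - F₂ ω) ∂μ| := abs_sub _ _
      _ ≤ M₁ * ∫ ω, |Y ω - F₂ ω| ∂μ + M₁ * ∫ ω, |Y ω - F₂ ω| ∂μ := by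
          rw [abs_mul]
          exact add_le_add t1 (mul_le_mul t3 t2 (abs_nonneg _) hM₁)
      _ = 2 * M₁ * ∫ ω, |Y ω - F₂ ω| ∂μ := by ring
  rw [e1, e2]
  calc |cov μ F₁ F₂ + cov μ F₁ (fun ω => Y ω - F₂ ω) + cov μ (fun ω => X ω - F₁ ω) Y|
      ≤ |cov μ F₁ F₂ + cov μ F₁ (fun ω => Y ω - F₂ ω)| + |cov μ (fun ω => X ω - F₁ ω) Y| :=
        abs_add_le _ _
    _ ≤ |cov μ F₁ F₂| + |cov μ F₁ (fun ω => Y ω - F₂ ω)| + |cov μ (fun ω => X ω - F₁ ω) Y| :=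
        add_le_add (abs_add_le _ _) le_rfl
    _ ≤ _ := by linarith

/-- Rate bookkeeping: a bound at rate `c'` is a bound at every smaller rate `c ≤ c'`, up to replacing the
constant by its positive part. -/
theorem mul_exp_rate_mono {T c c' a n : ℝ} (hc : c ≤ c') (ha : 0 ≤ a) (hn : 0 ≤ n) :
    T * Real.exp (-(c' * a * n)) ≤ max T 0 * Real.exp (-(c * a * n)) := by
  have h1 : T * Real.exp (-(c' * a * n)) ≤ max T 0 * Real.exp (-(c' * a * n)) :=
    mul_le_mul_of_nonneg_right (le_max_left _ _) (Real.exp_pos _).le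
  refine h1.trans (mul_le_mul_of_nonneg_left (Real.exp_le_exp.2 ?_) (le_max_right _ _))
  have : c * a * n ≤ c' * a * n := by
    have := mul_le_mul_of_nonneg_right (mul_le_mul_of_nonneg_right hc ha) hn
    exact this
  linarith

end Bookkeeping

section TorusFacts

variable {G : Type} [Group G] [TopologicalSpace G] [IsTopologicalGroup G] [CompactSpace G]
  [MeasurableSpace G] [BorelSpace G]

/-- The local femto σ-algebra sits below the Borel σ-algebra of torus gauge fields. -/
theorem femtoSigmaNear_le (r : LatticeRep G) (ℓf : ℝ) (a : ℝ → ℝ) (β : ℝ) (S : ℕ)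
    (x₀ : Fin 4 → ZMod (2 * S + 1)) (R : ℕ) :
    femtoSigmaNear r ℓf a β S x₀ R ≤ (inferInstance : MeasurableSpace (GaugeConfig 4 (2 * S + 1) G)) :=
  blockSigmaNear_le r _ x₀ R

/-- The femto σ-algebra sits below the Borel σ-algebra of torus gauge fields. -/
theorem femtoSigma_le (r : LatticeRep G) (ℓf : ℝ) (a : ℝ → ℝ) (β : ℝ) (S : ℕ) :
    femtoSigma r ℓf a β S ≤ (inferInstance : MeasurableSpace (GaugeConfig 4 (2 * S + 1) G)) :=
  blockSigma_le r _

omit [TopologicalSpace G] [IsTopologicalGroup G] [CompactSpace G] [BorelSpace G] in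
/-- Fine observables are bounded by the species' bound. -/
theorem abs_fineObs_le (S : ℕ) (A : YMSpecies G) {M : ℝ} (hM : ∀ U, |A.F U| ≤ M) (n : ℕ)
    (U : GaugeConfig 4 (2 * S + 1) G) : |fineObs S A n U| ≤ M :=
  hM _

/-- Conditional expectations of fine observables are a.e. bounded by the species' bound. -/
theorem ae_abs_condObs_le (r : LatticeRep G) (ℓf : ℝ) (a : ℝ → ℝ) (β : ℝ) (S : ℕ) (A : YMSpecies G)
    (n : ℕ) {M : ℝ} (hM : ∀ U, |A.F U| ≤ M) :
    ∀ᵐ U ∂(μW r β S), |condObs r ℓf a β S A n U| ≤ M := by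
  unfold condObs
  exact ae_bdd_abs_condExp_of_ae_bdd_abs (Eventually.of_forall fun U => abs_fineObs_le S A hM n U)

/-- Conditional expectations of fine observables are integrable. -/
theorem integrable_condObs (r : LatticeRep G) (ℓf : ℝ) (a : ℝ → ℝ) (β : ℝ) (S : ℕ) (A : YMSpecies G)
    (n : ℕ) : Integrable (condObs r ℓf a β S A n) (μW r β S) := by
  unfold condObs
  exact integrable_condExp

/-- A bounded local block functional is integrable under Wilson's measure. -/
theorem integrable_of_femtoSigmaNear (r : LatticeRep G) (ℓf : ℝ) (a : ℝ → ℝ) (β : ℝ) (S : ℕ)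
    (x₀ : Fin 4 → ZMod (2 * S + 1)) (R : ℕ) {F : GaugeConfig 4 (2 * S + 1) G → ℝ} {M : ℝ}
    (hF : Measurable[femtoSigmaNear r ℓf a β S x₀ R] F) (hFb : ∀ U, |F U| ≤ M) :
    Integrable F (μW r β S) := by
  haveI := isProbabilityMeasure_wilsonMeasure (d := 4) (L := 2 * S + 1) r.ρ r.continuous β
  have hF' : Measurable F := hF.mono (femtoSigmaNear_le r ℓf a β S x₀ R) le_rfl
  exact Integrable.of_bound hF'.aestronglyMeasurable M
    (Eventually.of_forall fun U => by rw [Real.norm_eq_abs]; exact hFb U)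

end TorusFacts

section Split

variable {G : Type} [Group G] [TopologicalSpace G] [IsTopologicalGroup G] [CompactSpace G]
  [MeasurableSpace G] [BorelSpace G]

omit [TopologicalSpace G] [IsTopologicalGroup G] [CompactSpace G] [BorelSpace G] in
/-- At zero time shift the fine observable is the plain torus restriction. -/
theorem fineObs_zero (S : ℕ) (A : YMSpecies G) :
    fineObs S A 0 = fun U => A.F (torusLift (2 * S + 1) U) := by
  funext U
  simp only [fineObs]
  congr 1
  funext e
  simp [configShift_apply]

omit [TopologicalSpace G] [IsTopologicalGroup G] [CompactSpace G] [BorelSpace G] in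
/-- Fine observables are measurable. -/
theorem measurable_fineObs (S : ℕ) (A : YMSpecies G) (n : ℕ) : Measurable (fineObs S A n) :=
  A.measurable.comp ((configShift _).measurable.comp (measurable_torusLift _))

/-- Fine observables are integrable under Wilson's measure. -/
theorem integrable_fineObs (r : LatticeRep G) (β : ℝ) (S : ℕ) (A : YMSpecies G) (n : ℕ) :
    Integrable (fineObs S A n) (μW r β S) := by
  haveI := isProbabilityMeasure_wilsonMeasure (d := 4) (L := 2 * S + 1) r.ρ r.continuous β
  obtain ⟨M, hM⟩ := A.bounded
  exact Integrable.of_bound (measurable_fineObs S A n).aestronglyMeasurable M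
    (Eventually.of_forall fun U => by rw [Real.norm_eq_abs]; exact hM _)

/-- Translation invariance: the Wilson mean of a time-shifted fine observable is the unshifted mean. -/
theorem integral_fineObs_eq (r : LatticeRep G) (β : ℝ) (S : ℕ) (B : YMSpecies G) (n : ℕ) :
    ∫ U, fineObs S B n U ∂(μW r β S) = ∫ U, B.F (torusLift (2 * S + 1) U) ∂(μW r β S) := by
  have h : fineObs S B n = toTorusObservable (2 * S + 1) (B.F ∘ configShift (-Pi.single 0 (n : ℤ))) := by
    funext U; rfl
  rw [h, toTorusObservable_comp_configShift]
  exact wilsonExpectation_comp_torusConfigShift (d := 4) (L := 2 * S + 1) r.ρ β _ _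

/-- **The exact split** (law of total covariance over the femto σ-algebra; proved, not a stub). -/
theorem totalCovarianceSplit : TotalCovarianceSplit := by
  intro G _ _ _ _ _ _ r ℓf a β S A B n
  haveI := isProbabilityMeasure_wilsonMeasure (d := 4) (L := 2 * S + 1) r.ρ r.continuous β
  have hm : femtoSigma r ℓf a β S ≤ (inferInstance : MeasurableSpace (GaugeConfig 4 (2 * S + 1) G)) :=
    femtoSigma_le r ℓf a β S
  -- the four functions
  set μ := μW r β S with hμ
  set f := fineObs S A 0 with hf
  set g := fineObs S B n with hg
  set X := condObs r ℓf a β S A 0 with hX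
  set Y := condObs r ℓf a β S B n with hY
  obtain ⟨MA, hMA⟩ := A.bounded
  obtain ⟨MB, hMB⟩ := B.bounded
  have hfi : Integrable f μ := integrable_fineObs r β S A 0
  have hgi : Integrable g μ := integrable_fineObs r β S B n
  have hXi : Integrable X μ := integrable_condObs r ℓf a β S A 0
  have hYi : Integrable Y μ := integrable_condObs r ℓf a β S B n
  have hgb : ∀ᵐ U ∂μ, |g U| ≤ MB := Eventually.of_forall fun U => hMB _
  have hfb : ∀ᵐ U ∂μ, |f U| ≤ MA := Eventually.of_forall fun U => hMA _
  have hXb : ∀ᵐ U ∂μ, |X U| ≤ MA := ae_abs_condObs_le r ℓf a β S A 0 hMA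
  have hYb : ∀ᵐ U ∂μ, |Y U| ≤ MB := ae_abs_condObs_le r ℓf a β S B n hMB
  have hfg : Integrable (fun U => f U * g U) μ := integrable_mul_of_bdd_right hfi hgi.1 hgb
  have hfY : Integrable (fun U => f U * Y U) μ := integrable_mul_of_bdd_right hfi hYi.1 hYb
  have hXg : Integrable (fun U => X U * g U) μ := integrable_mul_of_bdd_right hXi hgi.1 hgb
  have hXY : Integrable (fun U => X U * Y U) μ := integrable_mul_of_bdd_right hXi hYi.1 hYb
  -- conditional expectation identities
  have hXdef : X = μ[f|femtoSigma r ℓf a β S] := rfl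
  have hYdef : Y = μ[g|femtoSigma r ℓf a β S] := rfl
  have iX : ∫ U, X U ∂μ = ∫ U, f U ∂μ := by rw [hXdef]; exact integral_condExp hm
  have iY : ∫ U, Y U ∂μ = ∫ U, g U ∂μ := by rw [hYdef]; exact integral_condExp hm
  have ifY : ∫ U, f U * Y U ∂μ = ∫ U, X U * Y U ∂μ := by
    have hYf : Integrable (Y * f) μ := by
      have := integrable_mul_of_bdd_left hfi hYi.1 hYb
      exact this
    have hpull : μ[Y * f|femtoSigma r ℓf a β S] =ᵐ[μ] Y * μ[f|femtoSigma r ℓf a β S] :=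
      condExp_mul_of_stronglyMeasurable_left (by rw [hYdef]; exact stronglyMeasurable_condExp) hYf hfi
    calc ∫ U, f U * Y U ∂μ = ∫ U, (Y * f) U ∂μ := by
          congr 1; funext U; simp only [Pi.mul_apply]; ring
      _ = ∫ U, (μ[Y * f|femtoSigma r ℓf a β S]) U ∂μ := (integral_condExp hm).symm
      _ = ∫ U, (Y * μ[f|femtoSigma r ℓf a β S]) U ∂μ := integral_congr_ae hpull
      _ = ∫ U, X U * Y U ∂μ := by
          congr 1; funext U; rw [Pi.mul_apply, ← hXdef]; ring
  have iXg : ∫ U, X U * g U ∂μ = ∫ U, X U * Y U ∂μ := by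
    have hXg' : Integrable (X * g) μ := hXg
    have hpull : μ[X * g|femtoSigma r ℓf a β S] =ᵐ[μ] X * μ[g|femtoSigma r ℓf a β S] :=
      condExp_mul_of_stronglyMeasurable_left (by rw [hXdef]; exact stronglyMeasurable_condExp) hXg' hgi
    calc ∫ U, X U * g U ∂μ = ∫ U, (X * g) U ∂μ := rfl
      _ = ∫ U, (μ[X * g|femtoSigma r ℓf a β S]) U ∂μ := (integral_condExp hm).symm
      _ = ∫ U, (X * μ[g|femtoSigma r ℓf a β S]) U ∂μ := integral_congr_ae hpull
      _ = ∫ U, X U * Y U ∂μ := by rw [← hYdef]; rfl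
  -- the UV term expanded
  have huv : uvTerm r ℓf a β S A B n =
      (∫ U, f U * g U ∂μ) - (∫ U, f U * Y U ∂μ) - (∫ U, X U * g U ∂μ) + ∫ U, X U * Y U ∂μ := by
    have e : (fun U => (f U - X U) * (g U - Y U)) =
        fun U => f U * g U - f U * Y U - X U * g U + X U * Y U := by
      funext U; ring
    have h1 : Integrable (fun U => f U * g U - f U * Y U) μ := hfg.sub hfY
    have h2 : Integrable (fun U => f U * g U - f U * Y U - X U * g U) μ := h1.sub hXg
    show (∫ U, (f U - X U) * (g U - Y U) ∂μ) = _
    rw [e, integral_add h2 hXY, integral_sub h1 hXg, integral_sub hfg hfY]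
  -- the correlator in terms of f and g
  have hcorr : latticeConnectedCorr r.ρ β (2 * S + 1) A.F B.F n =
      (∫ U, f U * g U ∂μ) - (∫ U, f U ∂μ) * ∫ U, g U ∂μ := by
    rw [hg, integral_fineObs_eq r β S B n, hf, fineObs_zero S A]
    rfl
  rw [hcorr, huv, ifY, iXg]
  show _ = ((∫ U, X U * Y U ∂μ) - (∫ U, X U ∂μ) * ∫ U, Y U ∂μ) + _
  rw [iX, iY]
  ring

end Split

/-! ## §5 The four registered stubs and the checked compositions -/

/-- Stub 0 (DEFECT CARRIER — not a work item; identity on continuous rulers, false on the paper kill's slow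
step rulers exactly as the crux is; moot under the repair C′). -/
theorem stub_rulerReduction : RulerReduction := by
  sorry

/-- Stub 1 (XL, of a known kind: Bałaban / Gawędzki–Kupiainen constrained-fluctuation technology). -/
theorem stub_fluctuationCovarianceDecay : FluctuationCovarianceDecay := by
  sorry

/-- Stub 2 (L; same technology as stub 1: exponential decay of constrained propagators ⇒ quasi-local
conditional expectations). -/
theorem stub_condExpLocality : CondExpLocality := by
  sorry

/-- Stub 3 (open-problem grade, HARDEST: the residual crux as time-clustering of local bounded
functionals of the femto block field, i.e. of ONE family of block-field laws on a fixed coarse field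
space). -/
theorem stub_blockLawClustering : BlockLawClustering := by
  sorry

/-- The physics reduction: the three physics stubs imply the REPAIRED crux C′. -/
def PhysicsStubsImplyRepaired : Prop :=
  FluctuationCovarianceDecay → CondExpLocality → BlockLawClustering → CruxRepaired

/-- **The physics composition (kernel-checked, no `sorry`, axioms ⊆ {propext, Classical.choice, Quot.sound}).**
The three physics stub statements imply the repaired crux `CruxRepaired` (continuous rulers). Proof: fix
`G, r, a` continuous with `Package r a`; stubs 1 and 2 give femto thresholds `ℓ*₂, ℓ*₁`; stub 3 at `min ℓ*₁ ℓ*₂`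
gives the block size `ℓ_f` and `c₁, m₁, K, β₂ⁱ, S₁ⁱ`; instantiate stubs 1, 2 at `ℓ_f`. Rate
`c := min(c₂, c₁/2, κθ)`, `θ := c₁/(2 max(m₁,1))`; thresholds = maxima. For a pair `(A, B)` and
`β ≥ β₂`, `S ≥ S₁ β`, `n ≤ S`: the proved split `totalCovarianceSplit` writes the correlator as IR + UV;
stub 1 bounds `|UV| ≤ C_U e^{−c₂ a n}`; stub 2 at radius `R := ⌊θ a(β) n⌋` gives local approximants `F₁`
(of `E[A|𝓕]`, centre `0`) and `F₂` (of `E[τ_nB|𝓕]`, centre `n e₀`) with sup bounds `|C_A|, |C_B|` and `L¹`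
errors `≤ |C_·| e^{−κR}`; stub 3 bounds `|Cov(F₁,F₂)| ≤ K|C_A||C_B| e^{m₁R} e^{−c₁ a n} ≤ K|C_A||C_B|
e^{−(c₁/2) a n}` (`m₁ R ≤ (c₁/2) a n`); the proved bookkeeping `abs_cov_le_of_approx` (conditional
expectations are a.e. bounded by `‖B‖∞`, `ae_bdd_abs_condExp_of_ae_bdd_abs`) gives
`|IR| ≤ |Cov(F₁,F₂)| + 2‖B‖∞|C_A|e^{−κR} + 2|C_A||C_B|e^{−κR}` and `e^{−κR} ≤ e^{κ} e^{−κθ a n}`; every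
exponential is dominated by `e^{−c a n}` (`mul_exp_rate_mono`). -/
theorem physicsStubsImplyRepaired : PhysicsStubsImplyRepaired := by
  intro huv hloc hir G _ _ _ _ hG
  letI : MeasurableSpace G := borel G
  haveI : BorelSpace G := ⟨rfl⟩
  intro r a ha_cont hP
  -- positivity of the ruler (from the package)
  have ha_pos : ∀ β, 0 < a β := by
    obtain ⟨Γ, β₀, ℓ₀, c, C, -, -, hpos, -⟩ := hP
    exact hpos
  -- the two UV stubs give femto thresholds; the IR stub chooses the block scale below both
  obtain ⟨ℓs₂, hℓs₂, H2⟩ := huv G r a hP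
  obtain ⟨ℓs₁, hℓs₁, H1⟩ := hloc G r a hP
  obtain ⟨ℓf, hℓf, hℓfle, c₁, m₁, βI, K, SI, hc₁, hm₁, hK, HIR⟩ :=
    hir G hG r a ha_cont hP (min ℓs₁ ℓs₂) (lt_min hℓs₁ hℓs₂)
  obtain ⟨c₂, βU, SU, hc₂, HUV⟩ := H2 ℓf hℓf (hℓfle.trans (min_le_right _ _))
  obtain ⟨κ, βL, SL, hκ, HLOC⟩ := H1 ℓf hℓf (hℓfle.trans (min_le_left _ _))
  -- the rate
  set m₁' : ℝ := max m₁ 1 with hm₁'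
  have hm₁'pos : 0 < m₁' := lt_of_lt_of_le one_pos (le_max_right _ _)
  have hm₁le : m₁ ≤ m₁' := le_max_left _ _
  set θ : ℝ := c₁ / (2 * m₁') with hθ
  have hθpos : 0 < θ := div_pos hc₁ (by positivity)
  set cfin : ℝ := min c₂ (min (c₁ / 2) (κ * θ)) with hcfin
  have hcfin_pos : 0 < cfin := lt_min hc₂ (lt_min (half_pos hc₁) (mul_pos hκ hθpos))
  have hcfin₂ : cfin ≤ c₂ := min_le_left _ _
  have hcfin₁ : cfin ≤ c₁ / 2 := (min_le_right _ _).trans (min_le_left _ _)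
  have hcfinκ : cfin ≤ κ * θ := (min_le_right _ _).trans (min_le_right _ _)
  refine ⟨cfin, max (max βU βL) βI, fun β => max (max (SU β) (SL β)) (SI β), hcfin_pos, fun A B => ?_⟩
  obtain ⟨CU, hCU⟩ := HUV A B
  obtain ⟨CA, hCA⟩ := HLOC A
  obtain ⟨CB, hCB⟩ := HLOC B
  obtain ⟨MA, hMA⟩ := A.bounded
  obtain ⟨MB, hMB⟩ := B.bounded
  refine ⟨max CU 0 + K * |CA| * |CB| + (2 * |MB| * |CA| + 2 * |CA| * |CB|) * Real.exp κ,
    fun β hβ S n hS hn => ?_⟩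
  -- thresholds
  have hβU : βU ≤ β := le_trans (le_trans (le_max_left _ _) (le_max_left _ _)) hβ
  have hβL : βL ≤ β := le_trans (le_trans (le_max_right _ _) (le_max_left _ _)) hβ
  have hβI : βI ≤ β := le_trans (le_max_right _ _) hβ
  have hSU : SU β ≤ S := le_trans (le_trans (le_max_left _ _) (le_max_left _ _)) hS
  have hSL : SL β ≤ S := le_trans (le_trans (le_max_right _ _) (le_max_left _ _)) hS
  have hSI : SI β ≤ S := le_trans (le_max_right _ _) hS
  haveI := isProbabilityMeasure_wilsonMeasure (d := 4) (L := 2 * S + 1) r.ρ r.continuous β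
  have ha0 : 0 ≤ a β := (ha_pos β).le
  have hn0 : (0 : ℝ) ≤ n := Nat.cast_nonneg n
  have han : 0 ≤ a β * n := mul_nonneg ha0 hn0
  -- the coarse localisation radius `R = ⌊θ a(β) n⌋`
  set R : ℕ := ⌊θ * (a β * n)⌋₊ with hR
  have hRle : (R : ℝ) ≤ θ * (a β * n) := Nat.floor_le (mul_nonneg hθpos.le han)
  have hRgt : θ * (a β * n) < R + 1 := Nat.lt_floor_add_one _
  -- the proved split
  have hsp := totalCovarianceSplit G r ℓf a β S A B n
  -- stub 1: the UV term
  have hUVb : |uvTerm r ℓf a β S A B n| ≤ max CU 0 * Real.exp (-(cfin * a β * n)) :=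
    (hCU β hβU S n hSU hn).trans (mul_exp_rate_mono hcfin₂ ha0 hn0)
  -- stub 2: local approximants of the two conditional expectations
  obtain ⟨F₁, hF₁m, hF₁b, hF₁e⟩ := hCA β hβL S 0 hSL (Nat.zero_le _) R
  obtain ⟨F₂, hF₂m, hF₂b, hF₂e⟩ := hCB β hβL S n hSL hn R
  have hx₀ : (Pi.single 0 (((0 : ℕ) : ℕ) : ZMod (2 * S + 1)) : Fin 4 → ZMod (2 * S + 1)) = 0 := by
    simp
  rw [hx₀] at hF₁m
  have hF₁b' : ∀ U, |F₁ U| ≤ |CA| := fun U => (hF₁b U).trans (le_abs_self _)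
  have hF₂b' : ∀ U, |F₂ U| ≤ |CB| := fun U => (hF₂b U).trans (le_abs_self _)
  -- stub 3: clustering of the local block functionals
  have hIRb := HIR β hβI S n hSI hn R F₁ F₂ |CA| |CB| hF₁m hF₂m hF₁b' hF₂b'
  -- bookkeeping: the IR term is close to `cov F₁ F₂`
  have hX : Integrable (condObs r ℓf a β S A 0) (μW r β S) := integrable_condObs r ℓf a β S A 0
  have hY : Integrable (condObs r ℓf a β S B n) (μW r β S) := integrable_condObs r ℓf a β S B n
  have hYb : ∀ᵐ U ∂(μW r β S), |condObs r ℓf a β S B n U| ≤ |MB| :=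
    (ae_abs_condObs_le r ℓf a β S B n hMB).mono fun U h => h.trans (le_abs_self _)
  have hF₁i : Integrable F₁ (μW r β S) := integrable_of_femtoSigmaNear r ℓf a β S 0 R hF₁m hF₁b
  have hF₂i : Integrable F₂ (μW r β S) :=
    integrable_of_femtoSigmaNear r ℓf a β S _ R hF₂m hF₂b
  have hpert := abs_cov_le_of_approx (μW r β S) hX hY hF₁i hF₂i hYb
    (Eventually.of_forall hF₁b')
  -- exponent bookkeeping
  have hexp1 : Real.exp (m₁ * R) * Real.exp (-(c₁ * a β * n)) ≤ Real.exp (-(c₁ / 2 * a β * n)) := by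
    rw [← Real.exp_add]
    refine Real.exp_le_exp.2 ?_
    have h1 : m₁ * R ≤ m₁' * (θ * (a β * n)) :=
      (mul_le_mul_of_nonneg_right hm₁le (Nat.cast_nonneg R)).trans
        (mul_le_mul_of_nonneg_left hRle hm₁'pos.le)
    have h2 : m₁' * (θ * (a β * n)) = c₁ / 2 * (a β * n) := by
      rw [hθ]; field_simp
    have key : m₁ * (R : ℝ) ≤ c₁ / 2 * (a β * n) := h1.trans h2.le
    have e1 : c₁ * a β * (n : ℝ) = 2 * (c₁ / 2 * (a β * n)) := by ring
    have e2 : c₁ / 2 * a β * (n : ℝ) = c₁ / 2 * (a β * n) := by ring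
    rw [e1, e2]
    linarith
  have hexp2 : Real.exp (-(κ * R)) ≤ Real.exp κ * Real.exp (-(κ * θ * a β * n)) := by
    rw [← Real.exp_add]
    refine Real.exp_le_exp.2 ?_
    have h1 : κ * (θ * (a β * n)) ≤ κ * (R + 1) := (mul_lt_mul_of_pos_left hRgt hκ).le
    have e1 : κ * θ * a β * (n : ℝ) = κ * (θ * (a β * n)) := by ring
    rw [e1]
    linarith [mul_add κ (R : ℝ) 1]
  -- assemble
  have hI0 : 0 ≤ ∫ U, |condObs r ℓf a β S A 0 U - F₁ U| ∂(μW r β S) :=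
    integral_nonneg fun _ => abs_nonneg _
  have hJ0 : 0 ≤ ∫ U, |condObs r ℓf a β S B n U - F₂ U| ∂(μW r β S) :=
    integral_nonneg fun _ => abs_nonneg _
  have hT2 : |cov (μW r β S) F₁ F₂| ≤ K * |CA| * |CB| * Real.exp (-(cfin * a β * n)) := by
    have hcoef : 0 ≤ K * |CA| * |CB| := by positivity
    calc |cov (μW r β S) F₁ F₂|
        ≤ K * |CA| * |CB| * Real.exp (m₁ * R) * Real.exp (-(c₁ * a β * n)) := hIRb
      _ = K * |CA| * |CB| * (Real.exp (m₁ * R) * Real.exp (-(c₁ * a β * n))) := by ring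
      _ ≤ K * |CA| * |CB| * Real.exp (-(c₁ / 2 * a β * n)) := mul_le_mul_of_nonneg_left hexp1 hcoef
      _ ≤ max (K * |CA| * |CB|) 0 * Real.exp (-(cfin * a β * n)) := mul_exp_rate_mono hcfin₁ ha0 hn0
      _ = K * |CA| * |CB| * Real.exp (-(cfin * a β * n)) := by rw [max_eq_left hcoef]
  have hT3 : 2 * |MB| * ∫ U, |condObs r ℓf a β S A 0 U - F₁ U| ∂(μW r β S) +
      2 * |CA| * ∫ U, |condObs r ℓf a β S B n U - F₂ U| ∂(μW r β S) ≤
      (2 * |MB| * |CA| + 2 * |CA| * |CB|) * Real.exp κ * Real.exp (-(cfin * a β * n)) := by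
    have e1 : ∫ U, |condObs r ℓf a β S A 0 U - F₁ U| ∂(μW r β S) ≤ |CA| * Real.exp (-(κ * R)) :=
      hF₁e.trans (mul_le_mul_of_nonneg_right (le_abs_self _) (Real.exp_pos _).le)
    have e2 : ∫ U, |condObs r ℓf a β S B n U - F₂ U| ∂(μW r β S) ≤ |CB| * Real.exp (-(κ * R)) :=
      hF₂e.trans (mul_le_mul_of_nonneg_right (le_abs_self _) (Real.exp_pos _).le)
    have e3 : Real.exp (-(κ * θ * a β * n)) ≤ Real.exp (-(cfin * a β * n)) := by
      have := mul_exp_rate_mono (T := 1) hcfinκ ha0 hn0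
      rwa [one_mul, max_eq_left (zero_le_one' ℝ), one_mul] at this
    have hcoef : 0 ≤ 2 * |MB| * |CA| + 2 * |CA| * |CB| := by positivity
    calc 2 * |MB| * ∫ U, |condObs r ℓf a β S A 0 U - F₁ U| ∂(μW r β S) +
          2 * |CA| * ∫ U, |condObs r ℓf a β S B n U - F₂ U| ∂(μW r β S)
        ≤ 2 * |MB| * (|CA| * Real.exp (-(κ * R))) + 2 * |CA| * (|CB| * Real.exp (-(κ * R))) :=
          add_le_add (mul_le_mul_of_nonneg_left e1 (by positivity))
            (mul_le_mul_of_nonneg_left e2 (by positivity))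
      _ = (2 * |MB| * |CA| + 2 * |CA| * |CB|) * Real.exp (-(κ * R)) := by ring
      _ ≤ (2 * |MB| * |CA| + 2 * |CA| * |CB|) * (Real.exp κ * Real.exp (-(κ * θ * a β * n))) :=
          mul_le_mul_of_nonneg_left hexp2 hcoef
      _ ≤ (2 * |MB| * |CA| + 2 * |CA| * |CB|) * (Real.exp κ * Real.exp (-(cfin * a β * n))) :=
          mul_le_mul_of_nonneg_left (mul_le_mul_of_nonneg_left e3 (Real.exp_pos _).le) hcoef
      _ = (2 * |MB| * |CA| + 2 * |CA| * |CB|) * Real.exp κ * Real.exp (-(cfin * a β * n)) := by ring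
  have hIR : |irTerm r ℓf a β S A B n| ≤
      (K * |CA| * |CB| + (2 * |MB| * |CA| + 2 * |CA| * |CB|) * Real.exp κ) *
        Real.exp (-(cfin * a β * n)) := by
    unfold irTerm
    calc |cov (μW r β S) (condObs r ℓf a β S A 0) (condObs r ℓf a β S B n)|
        ≤ |cov (μW r β S) F₁ F₂| + 2 * |MB| * ∫ U, |condObs r ℓf a β S A 0 U - F₁ U| ∂(μW r β S) +
            2 * |CA| * ∫ U, |condObs r ℓf a β S B n U - F₂ U| ∂(μW r β S) := hpert
      _ = |cov (μW r β S) F₁ F₂| + (2 * |MB| * ∫ U, |condObs r ℓf a β S A 0 U - F₁ U| ∂(μW r β S) +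
            2 * |CA| * ∫ U, |condObs r ℓf a β S B n U - F₂ U| ∂(μW r β S)) := by ring
      _ ≤ K * |CA| * |CB| * Real.exp (-(cfin * a β * n)) +
            (2 * |MB| * |CA| + 2 * |CA| * |CB|) * Real.exp κ * Real.exp (-(cfin * a β * n)) :=
          add_le_add hT2 hT3
      _ = _ := by ring
  rw [hsp]
  calc |irTerm r ℓf a β S A B n + uvTerm r ℓf a β S A B n|
      ≤ |irTerm r ℓf a β S A B n| + |uvTerm r ℓf a β S A B n| := abs_add_le _ _
    _ ≤ (K * |CA| * |CB| + (2 * |MB| * |CA| + 2 * |CA| * |CB|) * Real.exp κ) *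
          Real.exp (-(cfin * a β * n)) + max CU 0 * Real.exp (-(cfin * a β * n)) := add_le_add hIR hUVb
    _ = (max CU 0 + K * |CA| * |CB| + (2 * |MB| * |CA| + 2 * |CA| * |CB|) * Real.exp κ) *
          Real.exp (-(cfin * a β * n)) := by ring

/-- The full reduction statement, wrapped in a `def` so that the hypothesis-free `LatticeGapInUVUnits_of`
below is the file's only theorem whose stated conclusion is the crux decl (the `#h21_check_skeleton` audit
admits no free `Prop` hypotheses). -/
def StubsImplyCrux : Prop :=
  RulerReduction → FluctuationCovarianceDecay → CondExpLocality → BlockLawClustering → LatticeGapInUVUnits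

/-- **The full composition (kernel-checked, no `sorry`).** The four stub statements imply the crux AS TYPED
(`∀ a`, BY NAME through `crux_iff`): stub 0 hands a continuous femto ruler `a'` with `a ≤ K₀ a'` eventually;
the physics composition gives `Concl r a'`; scale covariance (`concl_smul_iff`) gives `Concl r (K₀ a')`; the
conclusion only weakens along eventual minorants (`concl_of_eventually_le`), whence `Concl r a`. -/
theorem stubsImplyCrux : StubsImplyCrux := by
  intro hred huv hloc hir
  have hrep : CruxRepaired := physicsStubsImplyRepaired huv hloc hir
  refine crux_iff.2 fun G _ _ _ _ hG => ?_
  letI : MeasurableSpace G := borel G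
  haveI : BorelSpace G := ⟨rfl⟩
  intro r a hP
  obtain ⟨a', K₀, ha'c, hP', hK₀, hdom⟩ := hred G hG r a hP
  have h1 : Concl r a' := hrep G hG r a' ha'c hP'
  have h2 : Concl r (fun β => K₀ * a' β) := (concl_smul_iff r a' hK₀).2 h1
  exact concl_of_eventually_le r h2 hdom

/-- **The skeleton: the crux BY NAME from the four registered stubs** (its only `sorry`s are the stubs'; the
compositions `physicsStubsImplyRepaired`, `stubsImplyCrux` and the split `totalCovarianceSplit` are
sorry-free). -/
theorem LatticeGapInUVUnits_of : LatticeGapInUVUnits :=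
  stubsImplyCrux stub_rulerReduction stub_fluctuationCovarianceDecay stub_condExpLocality
    stub_blockLawClustering

/-- **The repaired crux C′ from the three PHYSICS stubs alone** (no defect carrier): what the line delivers the
moment the tenure planner restricts 9363/9366 to continuous unit maps. -/
theorem cruxRepaired_of_stubs : CruxRepaired :=
  physicsStubsImplyRepaired stub_fluctuationCovarianceDecay stub_condExpLocality stub_blockLawClustering

/-! ## §6 Checks against the landed Negative lemmas (`Theorems/LatticeGapInUVUnits/Negative/*`, imported) -/

section NegativeChecks

open Summit.QuantumFields.YangMills.Theorems.LatticeGapInUVUnits.Negative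

variable {G : Type} [Group G] [TopologicalSpace G] [IsTopologicalGroup G] [CompactSpace G]
  [MeasurableSpace G] [BorelSpace G]

/-- (`Negative.UniformConstantFalse`, Disproof §7) The observable-uniform strengthening of `Concl` is FALSE for
every compact simple `G`, every `r`, every `a`: all stubs and both compositions carry per-pair constants
(`∀ A B, ∃ C`; stub 3 scales with the sup norms `M₁ M₂`), so none of them concludes a shape this lemma refutes. -/
example (hG : IsCompactSimpleLieGroup G) (r : LatticeRep G) (a : ℝ → ℝ) :
    ¬ ∃ (c₁ β₂ C : ℝ) (S₁ : ℝ → ℕ), 0 < c₁ ∧ ∀ A B : YMSpecies G, ∀ β : ℝ, β₂ ≤ β → ∀ S n : ℕ,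
      S₁ β ≤ S → n ≤ S →
        |latticeConnectedCorr r.ρ β (2 * S + 1) A.F B.F n| ≤ C * Real.exp (-(c₁ * a β * n)) :=
  not_uniform_constant_clustering_of_simple hG r a

/-- (`Negative.WeakCouplingConcentration`, Disproof §6) **Tightness of the shared hypothesis**: every femto
package has `Γ(a(β)) → 0` (box `L = 8`, `n = 1` of `BoxBounds` fed to the landed
`shape_tendsto_zero_of_femto_lower_bound`). No stub of this line assumes `inf Γ > 0`; the UV stubs use only
`ℓ_f ≤ ℓ*` and the EXISTENCE of femto control below `ℓ_f`, never a lower bound on `Γ`. -/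
theorem packageWith_shape_tendsto_zero (r : LatticeRep G) {a Γ : ℝ → ℝ} {β₀ ℓ₀ c C : ℝ}
    (h : PackageWith r a Γ β₀ ℓ₀ c C) : Tendsto (fun β => Γ (a β)) atTop (𝓝 0) := by
  obtain ⟨hℓ, hc, hpos, hlim, hΓ, hbox⟩ := h
  haveI : NeZero (8 : ℕ) := ⟨by norm_num⟩
  have hev : ∀ᶠ β in atTop, a β < ℓ₀ / 8 := hlim (Iio_mem_nhds (by positivity))
  refine shape_tendsto_zero_of_femto_lower_bound r hc ?_ ?_
  · filter_upwards [hev] with β hβ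
    exact (hΓ (a β) (hpos β) (by linarith)).1.le
  · filter_upwards [hev, eventually_ge_atTop β₀] with β hβ hβ₀
    obtain ⟨hax, -⟩ := hbox 8 β hβ₀ (by push_cast; linarith)
    have h1 := (hax 1 le_rfl (by norm_num)).1
    simp only [Nat.cast_one, one_mul, one_pow] at h1
    exact h1

/-- (`Negative.WeakCouplingConcentration`, Disproof §3) **No junk through the gauge group**: for a trivial
(subsingleton) `G` the femto package is unsatisfiable (all plaquette covariances vanish, so the lower bound
`0 < c Γ(a β) ≤ Cov` fails in the box `L = 8`), hence the four stubs — all of which take `Package r a` —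
are vacuous there and no junk instance refutes them. -/
theorem not_package_of_subsingleton [Subsingleton G] (r : LatticeRep G) (a : ℝ → ℝ) : ¬ Package r a := by
  rintro ⟨Γ, β₀, ℓ₀, c, C, hℓ, hc, hpos, hlim, hΓ, hbox⟩
  haveI : NeZero (8 : ℕ) := ⟨by norm_num⟩
  have hev : ∀ᶠ β in atTop, a β < ℓ₀ / 8 := hlim (Iio_mem_nhds (by positivity))
  obtain ⟨β, hβ₀, hβ⟩ := ((eventually_ge_atTop β₀).and hev).exists
  obtain ⟨hax, -⟩ := hbox 8 β hβ₀ (by push_cast; linarith)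
  have h1 := (hax 1 le_rfl (by norm_num)).1
  simp only [Nat.cast_one, one_mul, one_pow] at h1
  have hΓ1 := (hΓ (a β) (hpos β) (by linarith)).1
  exact not_femto_lower_bound_of_subsingleton r ((0 : Fin 4 → ZMod 8), ⟨(0, 1), zero_lt_one_fin4⟩)
    ((Pi.single (2 : Fin 4) (1 : ZMod 8) : Fin 4 → ZMod 8), ⟨(0, 1), zero_lt_one_fin4⟩) β hc hΓ1 h1

/-- Consequently the crux (and each stub) holds VACUOUSLY at a trivial gauge group — whatever one deletes from
`IsCompactSimpleLieGroup`; the strength of every statement of this file sits in `Package r a`. -/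
example [Subsingleton G] (r : LatticeRep G) (a : ℝ → ℝ) : Package r a → Concl r a :=
  fun h => (not_package_of_subsingleton r a h).elim

end NegativeChecks

end Summit.QuantumFields.YangMills.Cruxes.LatticeGapInUVUnits.FemtoSigmaAlgebraSplit

end
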